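import Literature.Computability.Cryptography.ChenQuantumLWEChirpFourier
import Literature.Computability.Cryptography.ChenQuantumLWECountingLaw

/-!
# The spectral law of an arbitrary line profile: every window / smoothing variant of Step 9 at once (T9)

REPRODUCTION / ANALYSIS OF A CLAIMED RESULT UNDER ADJUDICATION (withdrawn): Yilei Chen, *Quantum
Algorithms for Lattice Problems*, IACR ePrint 2024/555, version of 2024-04-18 [ChenQuantumLattice2024]
(the version carrying the author's note that Step 9 contains a bug), Step 9 (§3.5.9, pp. 34–38) acting
on `|φ8.b⟩ = Σ_{j ∈ ℤ_P} e(-j²/P) |2D²j·b + v′ mod N⟩` (p. 35), `P = p₁Q`, `N = D²P`.  Bundle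
`papers/QuantumAdvantage/lwe-quantum-autopsy/`, Part 2 (`REPAIR-CENSUS.md` §1 theorem **T9** and §10),
companion of `ChenQuantumLWEChirpFourier.lean` (flat spectrum T3, oracle kick G1/T5) and
`ChenQuantumLWEClassTwirl.lean` (class twirl T4).
HONEST FRAMING: kernel-checked THEOREMS about states occurring in a WITHDRAWN algorithm — an exact
CRITERION deciding a whole family of proposed repairs (a precise negative result with its one positive
boundary case), NOT summit progress, no cryptanalytic claim in either direction, no new algorithm;
quantum lower bounds are out of scope.

## What is proved

Every "alternative window / smoothing / partial measurement along the line" variant of Steps 1–8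
(`REPAIR-CENSUS.md` rows B1–B4, F3, H2; T8) leaves, in the best case, the registers of one run in a
superposition over the hidden line `{2D²j·b + v′ : j ∈ ℤ_P} ⊂ ℤ_N^{n+1}` with SOME amplitude profile
`c : ℤ_P → ℂ` — the PROFILE KET `|c⟩ = Σ_j c(j) |2D²j·b + v′⟩` (`profileKet`; Chen's complex-Gaussian
window gives the chirp `c(j) = ψ_P(−j²)`, `phi8bKet_eq_profileKet`).  For Chen's unnormalised
`QFT_{ℤ_N^{n+1}}` (Lemma 2.12) and the hyperplane functional `t(u) = ⟨b, u mod P⟩ ∈ ℤ_P` (`lineFun`):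

* `weight_qft_profileKet` (**spectral law**): `|QFT|c⟩(u)|² = |ĉ(−2·t(u))|²` for EVERY outcome `u`,
  where `ĉ(s) = Σ_j c(j) ψ_P(js)` (`profileDFT`) — the unknown offset `v′` only contributes a global
  phase (`qft_profileKet`), a translate of the profile along the line contributes a phase
  (`profileDFT_translate`, `weight_qft_profileKet_translate`), a linear phase on the profile shifts the
  spectrum (`profileDFT_linPhase`).
* `card_lineFun_fibre` + `sum_weight_qft_profileKet` (Parseval, `profileDFT_parseval`): for odd `P` and
  `b₀ = −1` every fibre `{u : t(u) = t}` has `N^{n+1}/P` points and the total weight is `N^{n+1}·‖c‖²`.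
* **`prob_lineFun_eq` (T9)**: hence the Born probability that one run returns an outcome on the
  hyperplane `⟨b, u mod P⟩ = t` is EXACTLY `|ĉ(−2t)|² / (P·‖c‖²)` — a probability vector on `ℤ_P`
  determined by the profile alone (the same for every secret inside `b` and every offset `v′`).
  Regev's classical post-processing needs `≈ n` runs whose values `t` are KNOWN; a front end therefore
  survives iff its profile's spectrum `|ĉ|²` concentrates on `O(1)` known points.
* The three profiles that occur: the flat profile `c ≡ 1` (the ideal, un-chirped coset state) gives
  `t = 0` with certainty (`weight_qft_profileKet_one` — Regev's step works: the positive boundary case);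
  the chirp gives the uniform law `1/P` (`prob_chirp_univ`, = T3); a chirp restricted to ANY window
  `S ⊂ ℤ_P` (`windowedChirp`: narrower Gaussian, truncation, a partial measurement of `j`, B1/B3/F3/T8)
  gives `|G_S(t)|²/(P·|S|)` with the incomplete Gauss sum `G_S(t) = Σ_{j∈S} ψ_P(−(j+t)²)` (`incGauss`,
  `prob_windowedChirp_eq`), hence at most `|S|/P` (`prob_windowedChirp_le`): concentrating the law on
  `O(1)` values of `t` forces `|S| ≳ P`, where the state IS Chen's and the law is uniform.
* `kick_profileKet_chirp`, `weight_qft_kick_profileKet_chirp`: the oracle kick of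
  `ChenQuantumLWEChirpFourier` acts on every chirped profile `c(j)ψ_P(−j²)` by removing the chirp and
  inserting the linear phase of slope `2ε(w0)`, so the law becomes `|ĉ(−2(t − ε))|²/(P‖c‖²)` — a window
  does not repair a wrong guess of `v′₀ mod P` either (it only blurs the shifted hyperplane).
* `Shape`-level forms for every admissible shape (`Shape.prob_profile`, `Shape.prob_windowedChirp_le`,
  `Shape.prob_phi8b_lineFun`).

## What is NOT here

No claim about which profiles `c` a modified Steps 1–8 can actually produce (that needs re-deriving
Claims 3.9–3.12 for the new window; the census argues by hand that Karst-type windows reproduce a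
chirp); no bound on incomplete Gauss sums beyond the trivial `|G_S| ≤ |S|` (the Pólya–Vinogradov-type
bound `|G_S| ≤ √P(1 + log P)` of [Korobov1992, Ch. I §2 Thm 2, §3 Thm 3] is quoted in the census, not
formalised); nothing about module- or ring-LWE structure (rows C) or continuous variants (rows D), which the
census treats separately.
-/

namespace Literature.Computability.Cryptography.Chen2024

open scoped BigOperators

/-! ### The finite Fourier transform of a profile on `ℤ_P` -/

section Profile

variable (p₁ Q : ℕ+)

/-- The (unnormalised) Fourier transform of a line profile: `ĉ(s) = Σ_{j ∈ ℤ_P} c(j)·ψ_P(j·s)`.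
[folklore] -/
noncomputable def profileDFT (c : ZP p₁ Q → ℂ) (s : ZP p₁ Q) : ℂ :=
  ∑ j : ZP p₁ Q, c j * (ZMod.stdAddChar (j * s) : ℂ)

/-- Translating the profile along the line multiplies `ĉ` by a phase. [folklore] -/
theorem profileDFT_translate (c : ZP p₁ Q → ℂ) (j₀ s : ZP p₁ Q) :
    profileDFT p₁ Q (fun j => c (j - j₀)) s = ZMod.stdAddChar (j₀ * s) * profileDFT p₁ Q c s := by
  unfold profileDFT
  rw [Finset.mul_sum]
  refine Fintype.sum_equiv (Equiv.subRight j₀) _ _ fun j => ?_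
  simp only [Equiv.subRight_apply]
  rw [mul_left_comm, ← AddChar.map_add_eq_mul]
  congr 2
  ring

/-- A linear phase on the profile translates `ĉ`. [folklore] -/
theorem profileDFT_linPhase (c : ZP p₁ Q → ℂ) (ε s : ZP p₁ Q) :
    profileDFT p₁ Q (fun j => (ZMod.stdAddChar (j * ε) : ℂ) * c j) s = profileDFT p₁ Q c (s + ε) := by
  unfold profileDFT
  refine Finset.sum_congr rfl fun j _ => ?_
  dsimp only
  rw [mul_comm (ZMod.stdAddChar (j * ε) : ℂ), mul_assoc, ← AddChar.map_add_eq_mul]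
  congr 2
  ring

/-- A constant factor passes through `ĉ`. [folklore] -/
theorem profileDFT_const_mul (a : ℂ) (c : ZP p₁ Q → ℂ) (s : ZP p₁ Q) :
    profileDFT p₁ Q (fun j => a * c j) s = a * profileDFT p₁ Q c s := by
  unfold profileDFT
  rw [Finset.mul_sum]
  refine Finset.sum_congr rfl fun j _ => ?_
  ring

/-- **Parseval on `ℤ_P`**: `Σ_s |ĉ(s)|² = P · Σ_j |c(j)|²`. [folklore] -/
theorem profileDFT_parseval (c : ZP p₁ Q → ℂ) :
    ∑ s, ‖profileDFT p₁ Q c s‖ ^ 2 = (((p₁ * Q : ℕ+) : ℕ) : ℝ) * ∑ j, ‖c j‖ ^ 2 := by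
  have key : ∑ s, (starRingEnd ℂ) (profileDFT p₁ Q c s) * profileDFT p₁ Q c s
      = (((p₁ * Q : ℕ+) : ℕ) : ℂ) * ∑ j, (starRingEnd ℂ) (c j) * c j := by
    calc ∑ s, (starRingEnd ℂ) (profileDFT p₁ Q c s) * profileDFT p₁ Q c s
        = ∑ s : ZP p₁ Q, ∑ j : ZP p₁ Q, ∑ j' : ZP p₁ Q,
            (starRingEnd ℂ) (c j) * c j' * ZMod.stdAddChar (s * (j' - j)) := by
          refine Finset.sum_congr rfl fun s _ => ?_
          rw [profileDFT, map_sum, Finset.sum_mul_sum]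
          refine Finset.sum_congr rfl fun j _ => Finset.sum_congr rfl fun j' _ => ?_
          rw [map_mul, ← AddChar.map_neg_eq_conj, mul_mul_mul_comm, ← AddChar.map_add_eq_mul]
          congr 2
          ring
      _ = ∑ j : ZP p₁ Q, ∑ j' : ZP p₁ Q, (starRingEnd ℂ) (c j) * c j'
            * ∑ s : ZP p₁ Q, ZMod.stdAddChar (s * (j' - j)) := by
          rw [Finset.sum_comm]
          refine Finset.sum_congr rfl fun j _ => ?_
          rw [Finset.sum_comm]
          refine Finset.sum_congr rfl fun j' _ => ?_
          rw [Finset.mul_sum]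
      _ = ∑ j : ZP p₁ Q, ∑ j' : ZP p₁ Q, (starRingEnd ℂ) (c j) * c j'
            * (if j' - j = 0 then (((p₁ * Q : ℕ+) : ℕ) : ℂ) else 0) := by
          refine Finset.sum_congr rfl fun j _ => Finset.sum_congr rfl fun j' _ => ?_
          rw [AddChar.sum_mulShift (j' - j) (ZMod.isPrimitive_stdAddChar _), ZMod.card, Nat.cast_ite,
            Nat.cast_zero]
      _ = (((p₁ * Q : ℕ+) : ℕ) : ℂ) * ∑ j, (starRingEnd ℂ) (c j) * c j := by
          rw [Finset.mul_sum]
          refine Finset.sum_congr rfl fun j _ => ?_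
          simp_rw [sub_eq_zero, mul_ite, mul_zero]
          rw [Finset.sum_ite_eq' Finset.univ j]
          simp only [Finset.mem_univ, if_true]
          ring
  simp_rw [Complex.conj_mul'] at key
  exact_mod_cast key

/-- The flat profile: `𝟙̂(s) = P·[s = 0]`. [folklore] -/
theorem profileDFT_one (s : ZP p₁ Q) :
    profileDFT p₁ Q (fun _ => 1) s = if s = 0 then (((p₁ * Q : ℕ+) : ℕ) : ℂ) else 0 := by
  unfold profileDFT
  simp_rw [one_mul]
  rw [AddChar.sum_mulShift s (ZMod.isPrimitive_stdAddChar _), ZMod.card, Nat.cast_ite, Nat.cast_zero]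

/-- The INCOMPLETE GAUSS SUM of a window `S ⊂ ℤ_P` at shift `t`: `G_S(t) = Σ_{j ∈ S} ψ_P(−(j+t)²)`.
[cite: Korobov1992, Ch. I §2–§3] -/
noncomputable def incGauss (S : Finset (ZP p₁ Q)) (t : ZP p₁ Q) : ℂ :=
  ∑ j ∈ S, (ZMod.stdAddChar (-((j + t) ^ 2)) : ℂ)

/-- The WINDOWED CHIRP: Chen's chirp `ψ_P(−j²)` restricted to a window `S ⊂ ℤ_P` of line positions
(a narrower window in Step 1, a truncation, or the post-measurement state of a partial measurement of the
line coordinate). [cite: ChenQuantumLattice2024, §3.5.9 p. 35 (the chirped line); folklore] -/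
noncomputable def windowedChirp (S : Finset (ZP p₁ Q)) : ZP p₁ Q → ℂ :=
  fun j => if j ∈ S then (ZMod.stdAddChar (-(j ^ 2)) : ℂ) else 0

/-- The spectrum of a windowed chirp is an incomplete Gauss sum: `ĉ(−2t) = ψ_P(t²)·G_S(t)`
(completing the square). [cite: Korobov1992, Ch. I §3] -/
theorem profileDFT_windowedChirp (S : Finset (ZP p₁ Q)) (t : ZP p₁ Q) :
    profileDFT p₁ Q (windowedChirp p₁ Q S) (-(2 * t)) = ZMod.stdAddChar (t ^ 2) * incGauss p₁ Q S t := by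
  unfold profileDFT windowedChirp incGauss
  simp_rw [ite_mul, zero_mul]
  rw [Finset.sum_ite_mem, Finset.univ_inter, Finset.mul_sum]
  refine Finset.sum_congr rfl fun j _ => ?_
  rw [← AddChar.map_add_eq_mul, ← AddChar.map_add_eq_mul]
  congr 1
  ring

/-- Trivial bound `|G_S(t)| ≤ |S|`. [folklore] -/
theorem norm_incGauss_le (S : Finset (ZP p₁ Q)) (t : ZP p₁ Q) : ‖incGauss p₁ Q S t‖ ≤ S.card := by
  unfold incGauss
  calc ‖∑ j ∈ S, (ZMod.stdAddChar (-((j + t) ^ 2)) : ℂ)‖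
      ≤ ∑ j ∈ S, ‖(ZMod.stdAddChar (-((j + t) ^ 2)) : ℂ)‖ := norm_sum_le _ _
    _ = ∑ j ∈ S, (1 : ℝ) :=
        Finset.sum_congr rfl fun j _ => by rw [ZMod.stdAddChar_apply, Circle.norm_coe]
    _ = S.card := by simp

/-- The complete sum: `|G_{ℤ_P}(t)|² = P` for odd `P` (a quadratic Gauss sum with unit leading
coefficient). [cite: Korobov1992, Ch. I §3 Thm 3] -/
theorem norm_sq_incGauss_univ (hP : Odd ((p₁ * Q : ℕ+) : ℕ)) (t : ZP p₁ Q) :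
    ‖incGauss p₁ Q Finset.univ t‖ ^ 2 = ((p₁ * Q : ℕ+) : ℕ) := by
  unfold incGauss
  have h : ∑ j ∈ (Finset.univ : Finset (ZP p₁ Q)), (ZMod.stdAddChar (-((j + t) ^ 2)) : ℂ)
      = ∑ m : ZP p₁ Q, ZMod.stdAddChar ((-1) * m ^ 2 + 0 * m) := by
    refine Fintype.sum_equiv (Equiv.addRight t) _ _ fun j => ?_
    simp only [Equiv.coe_addRight]
    congr 1
    ring
  rw [h]
  exact Literature.NumberTheory.GaussSums.norm_sq_sum_stdAddChar_quadratic _ hP (-1) 0 isUnit_one.neg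

/-- `‖windowedChirp S‖² = |S|`. [folklore] -/
theorem sum_norm_sq_windowedChirp (S : Finset (ZP p₁ Q)) :
    ∑ j, ‖windowedChirp p₁ Q S j‖ ^ 2 = S.card := by
  have h : ∀ j, ‖windowedChirp p₁ Q S j‖ ^ 2 = if j ∈ S then (1 : ℝ) else 0 := by
    intro j
    unfold windowedChirp
    split_ifs
    · rw [ZMod.stdAddChar_apply, Circle.norm_coe, one_pow]
    · rw [norm_zero, zero_pow two_ne_zero]
  simp_rw [h]
  rw [Finset.sum_ite_mem, Finset.univ_inter, Finset.sum_const, nsmul_eq_mul, mul_one]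

end Profile

/-! ### Profile kets on the hidden line and their Fourier spectrum -/

section Line

variable (n : ℕ) (D p₁ Q : ℕ+) (b v' : Fin (n + 1) → ℤ)

/-- The PROFILE KET `|c⟩ = Σ_{j ∈ ℤ_P} c(j) |2D²j·b + v′ mod N⟩`: the hidden line of `|φ8.b⟩` with an
arbitrary amplitude profile `c` in place of Chen's chirp. [cite: ChenQuantumLattice2024, §3.5.9 p. 35] -/
noncomputable def profileKet (c : ZP p₁ Q → ℂ) : Ket (n + 1) ((D * D * (p₁ * Q) : ℕ+) : ℕ) :=
  lineKet (ptB n D p₁ Q b v') c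

/-- Chen's `|φ8.b⟩` is the profile ket of the chirp `ψ_P(−j²)`. [cite: ChenQuantumLattice2024, §3.5.9 p. 35] -/
theorem phi8bKet_eq_profileKet :
    phi8bKet n D p₁ Q b v' = profileKet n D p₁ Q b v' (fun j => (ZMod.stdAddChar (-(j ^ 2) : ZP p₁ Q) : ℂ)) :=
  rfl

/-- `QFT|c⟩(u) = ψ_N(−⟨v′,u⟩) · ĉ(−2·t(u))`: the offset is a global phase, the rest is the profile's
Fourier transform read at `−2⟨b, u mod P⟩`. [cite: ChenQuantumLattice2024, Lemma 2.12 p. 12, §3.5.9 p. 35] -/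
theorem qft_profileKet (c : ZP p₁ Q → ℂ) (u : Fin (n + 1) → ZN D p₁ Q) :
    qft (profileKet n D p₁ Q b v' c) u
      = ZMod.stdAddChar (-offsetFun n D p₁ Q v' u)
        * profileDFT p₁ Q c (-(2 * lineFun n D p₁ Q b u)) := by
  rw [profileKet, qft_lineKet, profileDFT, Finset.mul_sum]
  refine Finset.sum_congr rfl fun j _ => ?_
  rw [stdAddChar_neg_inner]
  ring

/-- **Spectral law.** `|QFT|c⟩(u)|² = |ĉ(−2·t(u))|²` for every outcome `u`, every `b`, every offset `v′`.
[cite: ChenQuantumLattice2024, §3.5.9 pp. 35–38; folklore] -/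
theorem weight_qft_profileKet (c : ZP p₁ Q → ℂ) (u : Fin (n + 1) → ZN D p₁ Q) :
    weight (qft (profileKet n D p₁ Q b v' c)) u = ‖profileDFT p₁ Q c (-(2 * lineFun n D p₁ Q b u))‖ ^ 2 := by
  rw [weight, qft_profileKet, norm_mul, mul_pow, ZMod.stdAddChar_apply, Circle.norm_coe, one_pow, one_mul]

/-- The law does not see the offset `v′` at all. [folklore] -/
theorem weight_qft_profileKet_offset_indep (v'' : Fin (n + 1) → ℤ) (c : ZP p₁ Q → ℂ)
    (u : Fin (n + 1) → ZN D p₁ Q) :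
    weight (qft (profileKet n D p₁ Q b v' c)) u = weight (qft (profileKet n D p₁ Q b v'' c)) u := by
  rw [weight_qft_profileKet, weight_qft_profileKet]

/-- The law depends on the outcome only through `t(u) = ⟨b, u mod P⟩`. [folklore] -/
theorem weight_qft_profileKet_eq_of_lineFun_eq (c : ZP p₁ Q → ℂ) {u u' : Fin (n + 1) → ZN D p₁ Q}
    (h : lineFun n D p₁ Q b u = lineFun n D p₁ Q b u') :
    weight (qft (profileKet n D p₁ Q b v' c)) u = weight (qft (profileKet n D p₁ Q b v' c)) u' := by
  rw [weight_qft_profileKet, weight_qft_profileKet, h]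

/-- A translate of the profile along the line (where on the line the window sits — unknown to the
algorithm, like `v′`) has the same law. [folklore] -/
theorem weight_qft_profileKet_translate (c : ZP p₁ Q → ℂ) (j₀ : ZP p₁ Q) (u : Fin (n + 1) → ZN D p₁ Q) :
    weight (qft (profileKet n D p₁ Q b v' (fun j => c (j - j₀)))) u
      = weight (qft (profileKet n D p₁ Q b v' c)) u := by
  rw [weight_qft_profileKet, weight_qft_profileKet, profileDFT_translate, norm_mul, ZMod.stdAddChar_apply,
    Circle.norm_coe, one_mul]

/-- A linear phase of slope `2ε` on the profile shifts the law by `ε`: `|ĉ(−2(t(u) − ε))|²`. [folklore] -/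
theorem weight_qft_profileKet_linPhase (c : ZP p₁ Q → ℂ) (ε : ZP p₁ Q) (u : Fin (n + 1) → ZN D p₁ Q) :
    weight (qft (profileKet n D p₁ Q b v' (fun j => (ZMod.stdAddChar (j * (2 * ε)) : ℂ) * c j))) u
      = ‖profileDFT p₁ Q c (-(2 * (lineFun n D p₁ Q b u - ε)))‖ ^ 2 := by
  rw [weight_qft_profileKet, profileDFT_linPhase,
    show -(2 * lineFun n D p₁ Q b u) + 2 * ε = -(2 * (lineFun n D p₁ Q b u - ε)) by ring]

/-- **The flat profile is the ideal coset state**: `|QFT|𝟙⟩(u)|² = P²·[⟨b, u mod P⟩ = 0]` (odd `P`) —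
without the chirp, Regev's relation `⟨b,u⟩ ≡ 0 (mod P)` holds with certainty.
[cite: ChenQuantumLattice2024, §3.5.9 p. 38 (eq. (41) with the intended conclusion); folklore] -/
theorem weight_qft_profileKet_one (hP : Odd ((p₁ * Q : ℕ+) : ℕ)) (u : Fin (n + 1) → ZN D p₁ Q) :
    weight (qft (profileKet n D p₁ Q b v' (fun _ => 1))) u
      = if lineFun n D p₁ Q b u = 0 then ((((p₁ * Q : ℕ+) : ℕ) : ℝ)) ^ 2 else 0 := by
  rw [weight_qft_profileKet, profileDFT_one]
  by_cases h : lineFun n D p₁ Q b u = 0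
  · rw [if_pos h, h, mul_zero, neg_zero, if_pos rfl, Complex.norm_natCast]
  · rw [if_neg h, if_neg, norm_zero, zero_pow two_ne_zero]
    intro h0
    apply h
    rw [neg_eq_zero] at h0
    exact (Literature.NumberTheory.GaussSums.isUnit_two_zmod_of_odd _ hP).mul_right_eq_zero.1 h0

/-- The windowed chirp's law is the incomplete Gauss sum: `|QFT|c_S⟩(u)|² = |G_S(t(u))|²`.
[cite: Korobov1992, Ch. I §3; folklore] -/
theorem weight_qft_windowedChirp (S : Finset (ZP p₁ Q)) (u : Fin (n + 1) → ZN D p₁ Q) :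
    weight (qft (profileKet n D p₁ Q b v' (windowedChirp p₁ Q S))) u
      = ‖incGauss p₁ Q S (lineFun n D p₁ Q b u)‖ ^ 2 := by
  rw [weight_qft_profileKet, profileDFT_windowedChirp, norm_mul, ZMod.stdAddChar_apply, Circle.norm_coe,
    one_mul]

/-! ### The oracle kick on a chirped profile -/

/-- The oracle kick with guess `w0` for `v′₀` acts on EVERY chirped profile `c(j)·ψ_P(−j²)` by removing
the chirp and inserting the linear phase of slope `2ε(w0)` (and the global phase `ψ_P(ε²)`).
[cite: ChenQuantumLattice2024, Lemma 2.13 p. 13, §3.5 p. 22, §3.5.9 p. 35] -/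
theorem kick_profileKet_chirp (hb : b 0 = -1) (hunit : IsUnit ((2 * D * D : ℕ) : ZP p₁ Q)) (w0 : ZN D p₁ Q)
    (c : ZP p₁ Q → ℂ) :
    kick (oracleKick n D p₁ Q w0)
        (profileKet n D p₁ Q b v' (fun j => c j * (ZMod.stdAddChar (-(j ^ 2) : ZP p₁ Q) : ℂ)))
      = profileKet n D p₁ Q b v' (fun j =>
          (ZMod.stdAddChar (centreError n D p₁ Q v' w0 ^ 2) : ℂ)
            * ((ZMod.stdAddChar (j * (2 * centreError n D p₁ Q v' w0)) : ℂ) * c j)) := by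
  rw [profileKet, profileKet, kick_lineKet]
  congr 1
  funext j
  simp only [oracleKick]
  rw [e_val_div_eq_stdAddChar, chirpCancelExponent_eq, kickIndex n D p₁ Q b v' hb hunit]
  have hphase : (ZMod.stdAddChar (-(j ^ 2) : ZP p₁ Q) : ℂ)
        * ZMod.stdAddChar ((j + centreError n D p₁ Q v' w0) ^ 2)
      = ZMod.stdAddChar (centreError n D p₁ Q v' w0 ^ 2)
        * ZMod.stdAddChar (j * (2 * centreError n D p₁ Q v' w0)) := by
    rw [← AddChar.map_add_eq_mul, ← AddChar.map_add_eq_mul]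
    congr 1
    ring
  rw [mul_assoc, hphase]
  ring

/-- **Law after the kick, any chirped profile**: `|ĉ(−2(t(u) − ε(w0)))|²` — the window's spectrum centred
on the SHIFTED hyperplane `⟨b, u mod P⟩ = ε(w0)` of `ChenQuantumLWEChirpFourier` (ε = 0 iff the guess is
right mod `P`). [cite: ChenQuantumLattice2024, §3.5.9 pp. 35–38] -/
theorem weight_qft_kick_profileKet_chirp (hb : b 0 = -1) (hunit : IsUnit ((2 * D * D : ℕ) : ZP p₁ Q))
    (w0 : ZN D p₁ Q) (c : ZP p₁ Q → ℂ) (u : Fin (n + 1) → ZN D p₁ Q) :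
    weight (qft (kick (oracleKick n D p₁ Q w0)
        (profileKet n D p₁ Q b v' (fun j => c j * (ZMod.stdAddChar (-(j ^ 2) : ZP p₁ Q) : ℂ))))) u
      = ‖profileDFT p₁ Q c (-(2 * (lineFun n D p₁ Q b u - centreError n D p₁ Q v' w0)))‖ ^ 2 := by
  rw [kick_profileKet_chirp n D p₁ Q b v' hb hunit, weight_qft_profileKet, profileDFT_const_mul,
    profileDFT_linPhase, norm_mul, ZMod.stdAddChar_apply, Circle.norm_coe, one_mul,
    show -(2 * lineFun n D p₁ Q b u) + 2 * centreError n D p₁ Q v' w0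
      = -(2 * (lineFun n D p₁ Q b u - centreError n D p₁ Q v' w0)) by ring]

/-! ### Fibres of the hyperplane functional, total weight, and the probability law (T9) -/

/-- `lineFun` is the counting law's `linFormMod` with modulus `P ∣ N`. [folklore] -/
theorem lineFun_eq_linFormMod (u : Fin (n + 1) → ZN D p₁ Q) :
    lineFun n D p₁ Q b u = linFormMod ((p₁ * Q : ℕ+) : ℕ) (P_dvd_N D (p₁ * Q)) b u := rfl

/-- Every fibre `{u : ⟨b, u mod P⟩ = t}` of `ℤ_N^{n+1}` has exactly `N^{n+1}/P` points (`b₀ = −1` is a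
Bezout witness). [cite: ChenQuantumLattice2024, eq. (12) p. 17 (`b₀ = −1`); folklore] -/
theorem card_lineFun_fibre (hb : b 0 = -1) (t : ZP p₁ Q) :
    (Finset.univ.filter fun u : Fin (n + 1) → ZN D p₁ Q => lineFun n D p₁ Q b u = t).card
        * ((p₁ * Q : ℕ+) : ℕ) = (((D * D * (p₁ * Q) : ℕ+) : ℕ)) ^ (n + 1) := by
  have hw : ((∑ i, (Pi.single (0 : Fin (n + 1)) (-1 : ℤ) : Fin (n + 1) → ℤ) i * b i : ℤ) : ZP p₁ Q)
      = 1 := by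
    rw [Fintype.sum_eq_single (0 : Fin (n + 1)) (fun i hi => by rw [Pi.single_eq_of_ne hi, zero_mul]),
      Pi.single_eq_same, hb]
    norm_num
  exact card_fibre_mul ((p₁ * Q : ℕ+) : ℕ) (P_dvd_N D (p₁ * Q)) b _ hw t

/-- The fibre size as a real number: `#fibre = N^{n+1}/P`. [folklore] -/
theorem card_lineFun_fibre_real (hb : b 0 = -1) (t : ZP p₁ Q) :
    ((Finset.univ.filter fun u : Fin (n + 1) → ZN D p₁ Q => lineFun n D p₁ Q b u = t).card : ℝ)
      = ((((D * D * (p₁ * Q) : ℕ+) : ℕ) : ℝ)) ^ (n + 1) / (((p₁ * Q : ℕ+) : ℕ) : ℝ) := by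
  rw [eq_div_iff (by exact_mod_cast PNat.ne_zero _ : (((p₁ * Q : ℕ+) : ℕ) : ℝ) ≠ 0)]
  exact_mod_cast card_lineFun_fibre n D p₁ Q b hb t

/-- Weight of one fibre: `#fibre · |ĉ(−2t)|²`. [folklore] -/
theorem sum_fibre_weight_qft_profileKet (c : ZP p₁ Q → ℂ) (t : ZP p₁ Q) :
    ∑ u ∈ Finset.univ.filter (fun u : Fin (n + 1) → ZN D p₁ Q => lineFun n D p₁ Q b u = t),
        weight (qft (profileKet n D p₁ Q b v' c)) u
      = (Finset.univ.filter fun u : Fin (n + 1) → ZN D p₁ Q => lineFun n D p₁ Q b u = t).card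
        * ‖profileDFT p₁ Q c (-(2 * t))‖ ^ 2 := by
  rw [Finset.sum_congr rfl fun u hu => by rw [weight_qft_profileKet, (Finset.mem_filter.1 hu).2],
    Finset.sum_const, nsmul_eq_mul]

/-- **Total weight** (Parseval through the fibres): `Σ_u |QFT|c⟩(u)|² = N^{n+1}·‖c‖²` for odd `P`,
`b₀ = −1`. [cite: ChenQuantumLattice2024, Lemma 2.12 p. 12; folklore] -/
theorem sum_weight_qft_profileKet (hP : Odd ((p₁ * Q : ℕ+) : ℕ)) (hb : b 0 = -1) (c : ZP p₁ Q → ℂ) :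
    ∑ u, weight (qft (profileKet n D p₁ Q b v' c)) u
      = ((((D * D * (p₁ * Q) : ℕ+) : ℕ) : ℝ)) ^ (n + 1) * ∑ j, ‖c j‖ ^ 2 := by
  have hP0 : (((p₁ * Q : ℕ+) : ℕ) : ℝ) ≠ 0 := by exact_mod_cast PNat.ne_zero _
  have h2 : IsUnit (-2 : ZP p₁ Q) :=
    (Literature.NumberTheory.GaussSums.isUnit_two_zmod_of_odd _ hP).neg
  have hre : ∑ t : ZP p₁ Q, ‖profileDFT p₁ Q c (-(2 * t))‖ ^ 2 = ∑ s, ‖profileDFT p₁ Q c s‖ ^ 2 :=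
    Fintype.sum_equiv h2.unit.mulLeft _ _ fun t => by simp [neg_mul]
  rw [← Finset.sum_fiberwise_of_maps_to (s := Finset.univ) (t := Finset.univ)
      (g := fun u : Fin (n + 1) → ZN D p₁ Q => lineFun n D p₁ Q b u) (fun u _ => Finset.mem_univ _)]
  simp_rw [sum_fibre_weight_qft_profileKet, card_lineFun_fibre_real n D p₁ Q b hb]
  rw [← Finset.mul_sum, hre, profileDFT_parseval]
  field_simp

/-- **T9 — the probability law of the hyperplane value**, multiplicative form:
`W(t)·(P‖c‖²) = |ĉ(−2t)|²·W_total`. [cite: ChenQuantumLattice2024, §3.5.9 pp. 35–38; folklore] -/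
theorem fibre_weight_mul_total (hP : Odd ((p₁ * Q : ℕ+) : ℕ)) (hb : b 0 = -1) (c : ZP p₁ Q → ℂ)
    (t : ZP p₁ Q) :
    (∑ u ∈ Finset.univ.filter (fun u : Fin (n + 1) → ZN D p₁ Q => lineFun n D p₁ Q b u = t),
        weight (qft (profileKet n D p₁ Q b v' c)) u)
        * ((((p₁ * Q : ℕ+) : ℕ) : ℝ) * ∑ j, ‖c j‖ ^ 2)
      = ‖profileDFT p₁ Q c (-(2 * t))‖ ^ 2 * ∑ u, weight (qft (profileKet n D p₁ Q b v' c)) u := by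
  have hP0 : (((p₁ * Q : ℕ+) : ℕ) : ℝ) ≠ 0 := by exact_mod_cast PNat.ne_zero _
  rw [sum_fibre_weight_qft_profileKet, sum_weight_qft_profileKet n D p₁ Q b v' hP hb,
    card_lineFun_fibre_real n D p₁ Q b hb]
  field_simp

/-- **T9 — the probability law of the hyperplane value**: for a non-zero profile `c`, the Born probability
that one run's Fourier sample `u` lies on `⟨b, u mod P⟩ = t` is EXACTLY `|ĉ(−2t)|² / (P‖c‖²)` — the
same for every secret inside `b` and every offset `v′`. [cite: ChenQuantumLattice2024, §3.5.9 pp. 35–38; folklore] -/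
theorem prob_lineFun_eq (hP : Odd ((p₁ * Q : ℕ+) : ℕ)) (hb : b 0 = -1) (c : ZP p₁ Q → ℂ)
    (hc : ∑ j, ‖c j‖ ^ 2 ≠ 0) (t : ZP p₁ Q) :
    (∑ u ∈ Finset.univ.filter (fun u : Fin (n + 1) → ZN D p₁ Q => lineFun n D p₁ Q b u = t),
        weight (qft (profileKet n D p₁ Q b v' c)) u)
        / ∑ u, weight (qft (profileKet n D p₁ Q b v' c)) u
      = ‖profileDFT p₁ Q c (-(2 * t))‖ ^ 2 / ((((p₁ * Q : ℕ+) : ℕ) : ℝ) * ∑ j, ‖c j‖ ^ 2) := by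
  have hP0 : (((p₁ * Q : ℕ+) : ℕ) : ℝ) ≠ 0 := by exact_mod_cast PNat.ne_zero _
  have hN0 : ((((D * D * (p₁ * Q) : ℕ+) : ℕ) : ℝ)) ≠ 0 := by exact_mod_cast PNat.ne_zero _
  have htot : ∑ u, weight (qft (profileKet n D p₁ Q b v' c)) u ≠ 0 := by
    rw [sum_weight_qft_profileKet n D p₁ Q b v' hP hb]
    exact mul_ne_zero (pow_ne_zero _ hN0) hc
  rw [div_eq_div_iff htot (mul_ne_zero hP0 hc)]
  exact fibre_weight_mul_total n D p₁ Q b v' hP hb c t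

/-- The sum of squares of a windowed chirp is positive for a non-empty window. [folklore] -/
theorem sum_norm_sq_windowedChirp_ne_zero (S : Finset (ZP p₁ Q)) (hS : S.Nonempty) :
    ∑ j, ‖windowedChirp p₁ Q S j‖ ^ 2 ≠ 0 := by
  rw [sum_norm_sq_windowedChirp]
  exact_mod_cast hS.card_pos.ne'

/-- **Windowed chirp**: the hyperplane value `t` has probability `|G_S(t)|² / (P·|S|)`.
[cite: Korobov1992, Ch. I §3; ChenQuantumLattice2024, §3.5.9 pp. 35–38] -/
theorem prob_windowedChirp_eq (hP : Odd ((p₁ * Q : ℕ+) : ℕ)) (hb : b 0 = -1) (S : Finset (ZP p₁ Q))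
    (hS : S.Nonempty) (t : ZP p₁ Q) :
    (∑ u ∈ Finset.univ.filter (fun u : Fin (n + 1) → ZN D p₁ Q => lineFun n D p₁ Q b u = t),
        weight (qft (profileKet n D p₁ Q b v' (windowedChirp p₁ Q S))) u)
        / ∑ u, weight (qft (profileKet n D p₁ Q b v' (windowedChirp p₁ Q S))) u
      = ‖incGauss p₁ Q S t‖ ^ 2 / ((((p₁ * Q : ℕ+) : ℕ) : ℝ) * S.card) := by
  rw [prob_lineFun_eq n D p₁ Q b v' hP hb _ (sum_norm_sq_windowedChirp_ne_zero p₁ Q S hS) t,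
    sum_norm_sq_windowedChirp, profileDFT_windowedChirp, norm_mul, ZMod.stdAddChar_apply, Circle.norm_coe,
    one_mul]

/-- **Windowed chirp, the no-go inequality**: every hyperplane value has probability at most `|S|/P` — a
law concentrated on `O(1)` values needs a window of size `≳ P`, i.e. (essentially) Chen's own state, whose
law is uniform. [cite: Korobov1992, Ch. I §3; ChenQuantumLattice2024, §3.5.9 pp. 35–38] -/
theorem prob_windowedChirp_le (hP : Odd ((p₁ * Q : ℕ+) : ℕ)) (hb : b 0 = -1) (S : Finset (ZP p₁ Q))
    (hS : S.Nonempty) (t : ZP p₁ Q) :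
    (∑ u ∈ Finset.univ.filter (fun u : Fin (n + 1) → ZN D p₁ Q => lineFun n D p₁ Q b u = t),
        weight (qft (profileKet n D p₁ Q b v' (windowedChirp p₁ Q S))) u)
        / ∑ u, weight (qft (profileKet n D p₁ Q b v' (windowedChirp p₁ Q S))) u
      ≤ (S.card : ℝ) / (((p₁ * Q : ℕ+) : ℕ) : ℝ) := by
  rw [prob_windowedChirp_eq n D p₁ Q b v' hP hb S hS t]
  have hP0 : (0 : ℝ) < (((p₁ * Q : ℕ+) : ℕ) : ℝ) := by exact_mod_cast PNat.pos _
  have hS0 : (0 : ℝ) < (S.card : ℝ) := by exact_mod_cast hS.card_pos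
  have hG : ‖incGauss p₁ Q S t‖ ≤ S.card := norm_incGauss_le p₁ Q S t
  calc ‖incGauss p₁ Q S t‖ ^ 2 / ((((p₁ * Q : ℕ+) : ℕ) : ℝ) * S.card)
      ≤ (S.card : ℝ) ^ 2 / ((((p₁ * Q : ℕ+) : ℕ) : ℝ) * S.card) := by gcongr
    _ = (S.card : ℝ) / (((p₁ * Q : ℕ+) : ℕ) : ℝ) := by
        field_simp

/-- **The full chirp (`S = ℤ_P`, Chen's state)**: every hyperplane value has probability exactly `1/P`
(T3 as a probability law). [cite: ChenQuantumLattice2024, §3.5.9 p. 35; Korobov1992, Ch. I §3 Thm 3] -/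
theorem prob_chirp_univ (hP : Odd ((p₁ * Q : ℕ+) : ℕ)) (hb : b 0 = -1) (t : ZP p₁ Q) :
    (∑ u ∈ Finset.univ.filter (fun u : Fin (n + 1) → ZN D p₁ Q => lineFun n D p₁ Q b u = t),
        weight (qft (profileKet n D p₁ Q b v' (windowedChirp p₁ Q Finset.univ))) u)
        / ∑ u, weight (qft (profileKet n D p₁ Q b v' (windowedChirp p₁ Q Finset.univ))) u
      = 1 / (((p₁ * Q : ℕ+) : ℕ) : ℝ) := by
  have hP0 : (((p₁ * Q : ℕ+) : ℕ) : ℝ) ≠ 0 := by exact_mod_cast PNat.ne_zero _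
  rw [prob_windowedChirp_eq n D p₁ Q b v' hP hb Finset.univ Finset.univ_nonempty t,
    norm_sq_incGauss_univ p₁ Q hP, Finset.card_univ, ZMod.card]
  field_simp

end Line

end Literature.Computability.Cryptography.Chen2024

/-! ### Shape-level corollaries (every admissible shape) -/

namespace Literature.Computability.Cryptography.Chen2024.Shape

open scoped BigOperators

variable (S : Shape)

/-- `Shape.phi8b` is the profile ket of the chirp. [cite: ChenQuantumLattice2024, §3.5.9 p. 35] -/
theorem phi8b_eq_profileKet :
    S.phi8b = profileKet S.n S.D S.p₁ S.Q S.b S.v'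
      (fun j => (ZMod.stdAddChar (-(j ^ 2) : ZP S.p₁ S.Q) : ℂ)) :=
  S.phi8b_eq_phi8bKet

/-- **T9 for every admissible shape**: with ANY profile `c ≠ 0` on the hidden line of `|φ8.b⟩`, the
hyperplane value `t = ⟨b, u mod P⟩` of one run has probability `|ĉ(−2t)|²/(P‖c‖²)`.
[cite: ChenQuantumLattice2024, §3.5.9 pp. 35–38; folklore] -/
theorem prob_profile (h : S.Admissible) (c : ZP S.p₁ S.Q → ℂ) (hc : ∑ j, ‖c j‖ ^ 2 ≠ 0)
    (t : ZP S.p₁ S.Q) :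
    (∑ u ∈ Finset.univ.filter (fun u : Fin (S.n + 1) → ZMod S.N => lineFun S.n S.D S.p₁ S.Q S.b u = t),
        weight (qft (profileKet S.n S.D S.p₁ S.Q S.b S.v' c)) u)
        / ∑ u, weight (qft (profileKet S.n S.D S.p₁ S.Q S.b S.v' c)) u
      = ‖profileDFT S.p₁ S.Q c (-(2 * t))‖ ^ 2 / (((S.P : ℕ) : ℝ) * ∑ j, ‖c j‖ ^ 2) :=
  prob_lineFun_eq S.n S.D S.p₁ S.Q S.b S.v' h.odd_P h.b_head c hc t

/-- **Windowed chirp for every admissible shape**: probability of any hyperplane value `≤ |S|/P`.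
[cite: Korobov1992, Ch. I §3; ChenQuantumLattice2024, §3.5.9 pp. 35–38] -/
theorem prob_windowedChirp_le (h : S.Admissible) (W : Finset (ZP S.p₁ S.Q)) (hW : W.Nonempty)
    (t : ZP S.p₁ S.Q) :
    (∑ u ∈ Finset.univ.filter (fun u : Fin (S.n + 1) → ZMod S.N => lineFun S.n S.D S.p₁ S.Q S.b u = t),
        weight (qft (profileKet S.n S.D S.p₁ S.Q S.b S.v' (windowedChirp S.p₁ S.Q W))) u)
        / ∑ u, weight (qft (profileKet S.n S.D S.p₁ S.Q S.b S.v' (windowedChirp S.p₁ S.Q W))) u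
      ≤ (W.card : ℝ) / ((S.P : ℕ) : ℝ) :=
  Chen2024.prob_windowedChirp_le S.n S.D S.p₁ S.Q S.b S.v' h.odd_P h.b_head W hW t

/-- **Chen's own state, every admissible shape**: the hyperplane value of one run of Step 9 WITHOUT the
kick is uniform on `ℤ_P` (probability `1/P` each). [cite: ChenQuantumLattice2024, §3.5.9 p. 35;
Korobov1992, Ch. I §3 Thm 3] -/
theorem prob_phi8b_lineFun (h : S.Admissible) (t : ZP S.p₁ S.Q) :
    (∑ u ∈ Finset.univ.filter (fun u : Fin (S.n + 1) → ZMod S.N => lineFun S.n S.D S.p₁ S.Q S.b u = t),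
        weight (qft S.phi8b) u)
        / ∑ u, weight (qft S.phi8b) u = 1 / ((S.P : ℕ) : ℝ) := by
  have hw : (fun j => (ZMod.stdAddChar (-(j ^ 2) : ZP S.p₁ S.Q) : ℂ))
      = windowedChirp S.p₁ S.Q Finset.univ := by
    funext j
    unfold windowedChirp
    rw [if_pos (Finset.mem_univ j)]
  rw [phi8b_eq_profileKet, hw]
  exact prob_chirp_univ S.n S.D S.p₁ S.Q S.b S.v' h.odd_P h.b_head t

end Literature.Computability.Cryptography.Chen2024.Shape
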